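import Mathlib
import HarnessLib
import Literature.Geometry.Lorentzian.Hintz2026.NashMoserInterface

/-!
# Hintz 2026, Thm 13.1 Step 3, Nash–Moser item (4): the support budget of the smoothing operators imported from
# Gluing II (Lemma 6.12 / Cor 6.14 / Thm 6.11) — "very small amounts (which sum to any small number, say ¼)" in the kernel

#harness_tags [topic Geometry/Lorentzian]

CITATION HEADER (lean-in-tree rule 2026-08-18).  P. Hintz, *Nonlinear stability of subextremal Kerr black holes*,
arXiv:2606.28253 **v2**, bib `Hintz2026` — an UNREFEREED CLAIM under adjudication (`@[claim "Hintz2026" "under-review"]`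
on `Literature.Geometry.Lorentzian.hintz_kerr_stability_subextremal_cauchy`); TeX lines `H l.N` of `kerr-stab-r.tex`.
Imported source: P. Hintz, *Gluing small black holes along timelike geodesics II*, arXiv:2408.06712, bib `Hintz2024GluingII`
("GII", UNREFEREED; TeX `glueloc2.tex`, "GII l.N"; public PDF pages).  Written by the audit cell `pub-kerr` (HINTZ-PLAN P33,
row 12); it DISCHARGES, with a concrete number, the one hypothesis of the cell's abstract support bookkeeping
`Hintz2026.NashMoserInterface.supported_seq_three_halves` (P13) that is a statement about the imported smoothing operators.

## What is printed

Hintz, proof of Thm 13.1, Step 3, item (4) (H l.15180): on the weighted b-Sobolev components "the smoothing operators of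
[GII, Lemma 6.12 and Corollary 6.14] can be used; these have the added benefit that they increase supports by very small
amounts (which sum to any small number, say `¼`, over the entire iteration scheme)".  GII Cor 6.14 (`CorNTameSmooth`, GII
l.5118–5125, proof l.5126–5128; PDF p.141): "there exist linear operators `S_θ`, `θ > 1`, mapping `L²(Ω_η)^{•,−} →
H^∞(Ω_{η−θ^{−1/2}})^{•,−}` satisfying … the [two Nash–Moser smoothing] estimates" — i.e. ONE application of `S_θ` costs `θ^{−1/2}`
of support (Lemma 6.12 (1) `ItNTameSmoothSupp0`, GII l.5082: support growth `< θ^{−δ}`, `δ ∈ (0,1)`; "so `δ = ½` is a possible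
choice", GII l.5076).  GII Thm 6.11 (`ThmNTameNM`, Nash–Moser), proof (ONE TeX line, GII l.5073): "the parameters `θ_j` in the
proof of [SR89, Lemma 1] are fixed by
`θ_j = θ₀^{(5/4)^j}`, with `θ₀` large. It then follows that `u_J ∈ B^∞_{η_J}` where `η_J = 1 − Σ_{j=0}^{J−1} θ_j^{−1/2}`. For
sufficiently large `θ₀`, we have `η_J > 0` for all `J`".  Saint-Raymond's schedule `θ_{k+1} = θ_k^{5/4}` is the tree's
`Literature.Analysis.Calculus.SaintRaymond.theta` (module `NashMoserSaintRaymond`, [SR89] Remark p.220).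

## What is proved here

With `η_k := θ_k^{−1/2}` (`eta`), for every `θ₀ ≥ 1`: `eta_succ_le` — `η_{k+1} ≤ θ₀^{−1/8}·η_k` (since `θ_{k+1}^{−1/2} =
θ_k^{−5/8} = θ_k^{−1/8}θ_k^{−1/2}` and `θ_k ≥ θ₀`); `eta_le_geom` — `η_k ≤ θ₀^{−1/2}(θ₀^{−1/8})^k`; `sum_eta_le` — for `θ₀ > 1`,
`Σ_{j<k} η_j ≤ θ₀^{−1/2}/(1 − θ₀^{−1/8})` for all `k`; `sum_eta_le_eighth` — **for `θ₀ ≥ 256`, `Σ_{j<k} η_j ≤ ⅛ (≤ ¼)` for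
all `k`** (`256^{−1/2} = 1/16`, `256^{−1/8} = ½`); and `supported_three_halves_of_GII` — the cell's `supported_seq_three_halves`
with its support-budget hypothesis `hsum` DISCHARGED for GII's cost `η_k = θ_k^{−1/2}` and `θ₀ ≥ 256`: along Saint-Raymond's
scheme every iterate's `h̃`-component stays supported in `𝔱_* ≥ 3/2` (H l.15183), given the three printed support facts
(H l.15168–15169, l.15177–15179, GII Cor 6.14).  The number `256` is a sufficient, not an optimal, threshold ("`θ₀` large").
Nothing here is an estimate; `Σ θ_j^{−1/2} < ∞` is the whole content.

v2 (audit cell, REFEREE #65 precision item P30, NIL for every result): (a) the GII TeX locators are now the exact lines of the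
public e-print `glueloc2.tex` (md5 150225951188): Thm 6.11's proof = l.5073 (v1 of this file printed "l.5074–5077"), Lemma 6.12
item (1) = l.5082 (v1: "l.5081"), Cor 6.14 statement l.5118–5125; (b) the smoothing hypothesis `hS` of
`supported_three_halves_of_GII` is now quantified over `1 < θ` EXACTLY as GII Cor 6.14 prints ("`S_θ`, `θ > 1`"); v1 asked for it
over `1 ≤ θ`, i.e. also at `θ = 1`, which GII does not supply — a needlessly strong hypothesis (the theorem was weaker than what GII
supports, never stronger); it is used only at the scheme's parameters `θ_k ≥ θ₀ ≥ 256 > 1`.  [cite: Hintz2026, proof of Thm 13.1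
Step 3 item (4), TeX l.15180-15183 (claim under review)] [cite: Hintz2024GluingII, Thm 6.11 proof (TeX l.5073), Lemma 6.12(1)
(l.5082), Cor 6.14 (l.5118-5125) (preprint)] [cite: SaintRaymond1989, Remark, p.220]
-/

open Finset Real

noncomputable section

namespace Literature.Geometry.Lorentzian.Hintz2026.SmoothingSupportBudget

open Literature.Analysis.Calculus Literature.Analysis.Calculus.SaintRaymond

variable {θ₀ : ℝ}

/-- GII Cor 6.14's support cost of one smoothing step at parameter `θ_k`: `η_k := θ_k^{−1/2}`
(`S_θ : L²(Ω_η)^{•,−} → H^∞(Ω_{η−θ^{−1/2}})^{•,−}`, `θ > 1`). [cite: Hintz2024GluingII, Cor 6.14 `CorNTameSmooth`, TeX l.5118-5125, PDF p.141] -/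
def eta (θ₀ : ℝ) (k : ℕ) : ℝ := theta θ₀ k ^ (-(1 / 2 : ℝ))

/-- [cite: Hintz2024GluingII, Cor 6.14 (definition unfolding)] -/
theorem eta_zero : eta θ₀ 0 = θ₀ ^ (-(1 / 2 : ℝ)) := by simp [eta]

/-- `η_k ≥ 0`. [cite: Hintz2024GluingII, Cor 6.14 (elementary)] -/
theorem eta_nonneg (h : 1 ≤ θ₀) (k : ℕ) : 0 ≤ eta θ₀ k := Real.rpow_nonneg (theta_pos h k).le _

/-- One step of the schedule: `η_{k+1} = θ_k^{−5/8} = θ_k^{−1/8}·θ_k^{−1/2} ≤ θ₀^{−1/8}·η_k`.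
[cite: Hintz2024GluingII, Thm 6.11 proof, TeX l.5073 (`θ_j = θ₀^{(5/4)^j}`); SaintRaymond1989, Remark p.220] -/
theorem eta_succ_le (h : 1 ≤ θ₀) (k : ℕ) : eta θ₀ (k + 1) ≤ θ₀ ^ (-(1 / 8 : ℝ)) * eta θ₀ k := by
  have hpos := theta_pos h k
  unfold eta
  rw [theta_succ_rpow h k, show (5 : ℝ) / 4 * -(1 / 2) = -(1 / 8) + -(1 / 2) by norm_num, Real.rpow_add hpos]
  have h1 : theta θ₀ k ^ (-(1 / 8 : ℝ)) ≤ θ₀ ^ (-(1 / 8 : ℝ)) :=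
    Real.rpow_le_rpow_of_nonpos (by linarith) (le_theta h k) (by norm_num)
  exact mul_le_mul_of_nonneg_right h1 (Real.rpow_nonneg hpos.le _)

/-- Geometric majorant: `η_k ≤ θ₀^{−1/2}·(θ₀^{−1/8})^k`. [cite: Hintz2024GluingII, Thm 6.11 proof (elementary consequence)] -/
theorem eta_le_geom (h : 1 ≤ θ₀) (k : ℕ) : eta θ₀ k ≤ θ₀ ^ (-(1 / 2 : ℝ)) * (θ₀ ^ (-(1 / 8 : ℝ))) ^ k := by
  induction k with
  | zero => simp [eta_zero]
  | succ k ih =>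
    have hq : 0 ≤ θ₀ ^ (-(1 / 8 : ℝ)) := Real.rpow_nonneg (by linarith) _
    calc eta θ₀ (k + 1) ≤ θ₀ ^ (-(1 / 8 : ℝ)) * eta θ₀ k := eta_succ_le h k
      _ ≤ θ₀ ^ (-(1 / 8 : ℝ)) * (θ₀ ^ (-(1 / 2 : ℝ)) * (θ₀ ^ (-(1 / 8 : ℝ))) ^ k) :=
          mul_le_mul_of_nonneg_left ih hq
      _ = θ₀ ^ (-(1 / 2 : ℝ)) * (θ₀ ^ (-(1 / 8 : ℝ))) ^ (k + 1) := by ring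

/-- Finite geometric sums below `1/(1−q)`. [folklore] -/
theorem geom_sum_le_inv (q : ℝ) (hq0 : 0 ≤ q) (hq1 : q < 1) (n : ℕ) : ∑ i ∈ range n, q ^ i ≤ 1 / (1 - q) := by
  rw [geom_sum_eq (ne_of_lt hq1) n]
  have h1 : 0 < 1 - q := by linarith
  have hqn : 0 ≤ q ^ n := pow_nonneg hq0 n
  rw [show (q ^ n - 1) / (q - 1) = (1 - q ^ n) / (1 - q) by
    rw [← neg_sub 1 (q ^ n), ← neg_sub 1 q, neg_div_neg_eq]]
  exact div_le_div_of_nonneg_right (by linarith) h1.le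

/-- The whole budget: for `θ₀ > 1` and every `k`, `Σ_{j<k} η_j ≤ θ₀^{−1/2}/(1 − θ₀^{−1/8})` — "`η_J > 0` for all `J`"
once the right side is `< 1`. [cite: Hintz2024GluingII, Thm 6.11 proof, TeX l.5073] -/
theorem sum_eta_le (h : 1 < θ₀) (k : ℕ) :
    ∑ j ∈ range k, eta θ₀ j ≤ θ₀ ^ (-(1 / 2 : ℝ)) / (1 - θ₀ ^ (-(1 / 8 : ℝ))) := by
  have hq0 : 0 ≤ θ₀ ^ (-(1 / 8 : ℝ)) := Real.rpow_nonneg (by linarith) _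
  have hq1 : θ₀ ^ (-(1 / 8 : ℝ)) < 1 := Real.rpow_lt_one_of_one_lt_of_neg h (by norm_num)
  have ha : 0 ≤ θ₀ ^ (-(1 / 2 : ℝ)) := Real.rpow_nonneg (by linarith) _
  calc ∑ j ∈ range k, eta θ₀ j ≤ ∑ j ∈ range k, θ₀ ^ (-(1 / 2 : ℝ)) * (θ₀ ^ (-(1 / 8 : ℝ))) ^ j :=
        sum_le_sum fun j _ => eta_le_geom h.le j
    _ = θ₀ ^ (-(1 / 2 : ℝ)) * ∑ j ∈ range k, (θ₀ ^ (-(1 / 8 : ℝ))) ^ j := by rw [mul_sum]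
    _ ≤ θ₀ ^ (-(1 / 2 : ℝ)) * (1 / (1 - θ₀ ^ (-(1 / 8 : ℝ)))) :=
        mul_le_mul_of_nonneg_left (geom_sum_le_inv _ hq0 hq1 k) ha
    _ = θ₀ ^ (-(1 / 2 : ℝ)) / (1 - θ₀ ^ (-(1 / 8 : ℝ))) := by ring

/-- `256^{−1/2} = 1/16`. [folklore] -/
theorem rpow_256_neg_half : (256 : ℝ) ^ (-(1 / 2 : ℝ)) = 1 / 16 := by
  rw [show (256 : ℝ) = (16 : ℝ) ^ (2 : ℝ) by norm_num, ← Real.rpow_mul (by norm_num : (0 : ℝ) ≤ 16)]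
  norm_num

/-- `256^{−1/8} = 1/2`. [folklore] -/
theorem rpow_256_neg_eighth : (256 : ℝ) ^ (-(1 / 8 : ℝ)) = 1 / 2 := by
  rw [show (256 : ℝ) = (2 : ℝ) ^ (8 : ℝ) by norm_num, ← Real.rpow_mul (by norm_num : (0 : ℝ) ≤ 2)]
  norm_num

/-- **A sufficient "`θ₀` large"**: for `θ₀ ≥ 256` the total support cost of the whole scheme is `≤ ⅛`, uniformly in the
number of steps. [cite: Hintz2026, TeX l.15180 ("sum to any small number, say ¼"); Hintz2024GluingII, Thm 6.11 proof] -/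
theorem sum_eta_le_eighth (h : 256 ≤ θ₀) (k : ℕ) : ∑ j ∈ range k, eta θ₀ j ≤ 1 / 8 := by
  have h1 : (1 : ℝ) < θ₀ := by linarith
  have ha : θ₀ ^ (-(1 / 2 : ℝ)) ≤ 1 / 16 := by
    rw [← rpow_256_neg_half]; exact Real.rpow_le_rpow_of_nonpos (by norm_num) h (by norm_num)
  have hq : θ₀ ^ (-(1 / 8 : ℝ)) ≤ 1 / 2 := by
    rw [← rpow_256_neg_eighth]; exact Real.rpow_le_rpow_of_nonpos (by norm_num) h (by norm_num)
  have ha0 : 0 ≤ θ₀ ^ (-(1 / 2 : ℝ)) := Real.rpow_nonneg (by linarith) _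
  have hden : (1 : ℝ) / 2 ≤ 1 - θ₀ ^ (-(1 / 8 : ℝ)) := by linarith
  calc ∑ j ∈ range k, eta θ₀ j ≤ θ₀ ^ (-(1 / 2 : ℝ)) / (1 - θ₀ ^ (-(1 / 8 : ℝ))) := sum_eta_le h1 k
    _ ≤ (1 / 16) / (1 / 2) := by
        apply div_le_div₀ (by norm_num) ha (by norm_num) hden
    _ = 1 / 8 := by norm_num

/-- The scheme's parameters lie in GII Cor 6.14's range `θ > 1` as soon as `θ₀ > 1` (so `hS` below is only ever invoked where
GII supplies `S_θ`). [cite: Hintz2024GluingII, Cor 6.14, TeX l.5120 ("`S_θ`, `θ > 1`"); SaintRaymond1989, Remark p.220] -/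
theorem one_lt_theta (h : 1 < θ₀) (k : ℕ) : 1 < theta θ₀ k := h.trans_le (le_theta h.le k)

/-- Hence Hintz's "say ¼". [cite: Hintz2026, TeX l.15180] -/
theorem sum_eta_le_quarter (h : 256 ≤ θ₀) (k : ℕ) : ∑ j ∈ range k, eta θ₀ j ≤ 1 / 4 :=
  (sum_eta_le_eighth h k).trans (by norm_num)

/-- **The support conclusion of Step 3 with GII's smoothing operators** — the cell's abstract bookkeeping theorem
`NashMoserInterface.supported_seq_three_halves` with its support-budget hypothesis DISCHARGED: if `S_θ`, `θ > 1`, enlarges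
supports by at most `θ^{−1/2}` (GII Cor 6.14, hypothesis `hS` — quantified over `1 < θ` as printed; v2), `P∘Ψ` preserves
"supported in `𝔱_* ≥ c`" for `c ∈ [3/2, 7/4]` (H l.15168–15169), the solution operator of item (3) transports supports (finite speed, H l.15177–15179), and `θ₀ ≥ 256`, then every iterate
`u_k` of Saint-Raymond's scheme started at `u₀` with `h̃(u₀) ⊂ {𝔱_* ≥ 7/4}` has `h̃(u_k) ⊂ {𝔱_* ≥ 3/2}` (H l.15183: "the final
component `h̃` of `U` automatically has support in `𝔱_* ≥ 3/2`"). [cite: Hintz2026, proof of Thm 13.1 Step 3, TeX l.15160-15183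
(bookkeeping proved; the three support hypotheses are the paper's); Hintz2024GluingII, Cor 6.14] -/
theorem supported_three_halves_of_GII {E : Type*} {F : Type*} [AddCommGroup E]
    (S : ℝ → E → E) (φ : E → F) (ψ : E → F → E) (u₀ : E) (θ₀ : ℝ) (hθ : 256 ≤ θ₀)
    (SuppE : ℝ → E → Prop) (SuppF : ℝ → F → Prop)
    (anti : ∀ c c' : ℝ, c' ≤ c → ∀ x : E, SuppE c x → SuppE c' x)
    (add : ∀ c : ℝ, ∀ x y : E, SuppE c x → SuppE c y → SuppE c (x + y))
    (neg : ∀ c : ℝ, ∀ x : E, SuppE c x → SuppE c (-x))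
    (hφ : ∀ c : ℝ, 3 / 2 ≤ c → c ≤ 7 / 4 → ∀ u : E, SuppE c u → SuppF c (φ u))
    (hψ : ∀ c : ℝ, 3 / 2 ≤ c → c ≤ 7 / 4 → ∀ u : E, ∀ f : F, SuppF c f → SuppE c (ψ u f))
    (hS : ∀ θ : ℝ, 1 < θ → ∀ c : ℝ, ∀ x : E, SuppE c x → SuppE (c - θ ^ (-(1 / 2 : ℝ))) (S θ x))
    (h0 : SuppE (7 / 4) u₀) (k : ℕ) :
    SuppE (3 / 2) (SaintRaymond.seq S φ ψ u₀ θ₀ k) := by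
  have h1 : (1 : ℝ) ≤ θ₀ := by linarith
  have h1' : (1 : ℝ) < θ₀ := by linarith
  exact NashMoserInterface.supported_seq_three_halves S φ ψ u₀ θ₀ SuppE SuppF (eta θ₀) (eta_nonneg h1)
    (sum_eta_le_quarter hθ) anti add neg hφ hψ (fun k c x hx => hS _ (h1'.trans_le (le_theta h1 k)) c x hx) h0 k

end Literature.Geometry.Lorentzian.Hintz2026.SmoothingSupportBudget

end
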